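import Literature.IUT.LogVolume.Corollary22Legendre
import Literature.NumberTheory.DiophantineGeometry.GenEllGaloisImageTwist
import Literature.NumberTheory.DiophantineGeometry.LocalReductionHasMultiplicativeReductionAtProofs
import Literature.NumberTheory.DiophantineGeometry.LocalReductionIsIntegralAtProofs
import Literature.NumberTheory.DiophantineGeometry.MinimalDiscriminantNormProofs
import Literature.NumberTheory.EllipticCurves.OpenImageMazurProofs
import Literature.NumberTheory.EllipticCurves.PointCountEulerCriterion
import Literature.NumberTheory.EllipticCurves.ComplexMultiplicationLocalFactorsAux
import Summits.BirchSwinnertonDyer.Rank2.IntModelLocalData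
import Mathlib.NumberTheory.Padics.HeightOneSpectrum
import HarnessLib

/-!
# Branch C / R-W task «C:HSHW-REF», (P6) DISCHARGED: `Cor22.CondP6 (ratPoint λ) l` for `λ = 2·5¹⁰·13⁴/(11⁸·109²·3677³)`
# and `l ∈ {11, 13, 17, 19}` — the Galois image on the `l`-torsion of the Frey–Legendre curve contains `SL₂(𝔽_l)`, IN KERNEL

PROOF-ONLY file (D-0012; 0 definitions, 0 `Prop` facts, no instance, no notation) of the abc-iut cell (seat abc-iut-w6-d102,
gen 4; director-abc 21:13:13Z (b) «NEXT C:HSHW-REF TARGET = the (P6) DISCHARGE at (λ_3677, 13)»). It removes the ONLY hypothesis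
`Cor22.CondP6 (ratPoint λ) l` of this seat's apices `Conditional.not_hSHwBad_frey` (l = 13, p467486), `…_eleven` (p467802),
`…_seventeen` (p468473). NO new fact, NO database citation: every classical input is an existing tree THEOREM.

The statement (S. Mochizuki, *Inter-universal Teichmüller theory IV*, RIMS manuscript (Apr. 2020; = PRIMS **57** (2021)), proof of
Cor. 2.2 (ii), (P6) p. 46; = [IUTchI] Def. 3.1 (c)): "the image of the outer homomorphism `Gal(Q̄/F) → GL₂(𝔽_l)` determined by the
`l`-torsion points of `E_F` contains the subgroup `SL₂(𝔽_l)`", for the Legendre curve `E : y² = x(x−1)(x−λ)` over every theta-field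
`F = ℚ(√−1, E[3·5])` (the tree's `Cor22.IsThetaField`, typed `Cor22.CondP6`, `Corollary22Legendre.lean`). For THIS `λ` (the abc
triple `2·5¹⁰13⁴ + 3¹⁵7·31⁷45817 = 11⁸109²3677³`, `a = 2·5¹⁰13⁴`, `c = 11⁸109²3677³`, `b = c − a`) it is classical arithmetic:

* §1 the integer model `E₁ = [0, −(c²+ac), 0, ac³, 0]` (`y² = x(x − c²)(x − ac)`, `Δ(E₁) = 16a²b²c⁸`; `⟨c,0,0,0⟩ • E₁ =` Legendre
  model, §3) has good reduction at `29 ∤ Δ` with `#Ẽ₁(𝔽₂₉) = 36`, `a₂₉ = −6` (kernel count by Euler's criterion, the tree's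
  `card_sol_eq_sum_euler` / `natCard_point_eq_one_add_card`, pattern of `Curve5077aPointCounts`); `t² + 6t + 29` has no root mod
  `l ∈ {11,13,17,19}`, so **`ρ̄_{E,l}` is irreducible over `ℚ`** by MAZUR'S FROBENIUS CERTIFICATE (Mazur 1978 Prop. 6.3 (1)) = tree
  theorem `Summit.BirchSwinnertonDyer.Rank2.hasIrreducibleModPGaloisRep_map_of_noroot` (cell bsd-rank2; cross-summit import as in
  `IUTFork/MLFGaloisTFG.lean`), resting on Serre's `tr ρ̄_l(Frob_p) = a_p` (`trace_galoisRepTorsion_frobenius_eq`);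
* §2 at the place `v₇` of `ℚ` over `7`: `7 ∤ c₄(E₁)` and `ord₇ Δ(E₁) = 2`, so `E₁/ℚ` is integral, minimal and MULTIPLICATIVE at `v₇`
  with `ord₇(Δ_min) = 2` (Silverman AEC VII.1 Rem. 1.1, VII.5 Prop. 5.1(b); tree `isMinimalAt_of_lt_valuation_c₄`,
  `hasMultiplicativeReductionAt_of_valuation_c₄_eq_one`, `valuation_Δ_eq_of_isMinimalAt_holds`, pattern of `GenEllCurve37aWitnesses`);
* §3 **`Im(Gal(Q̄/ℚ) → Aut E[l]) ⊇ SL₂(𝔽_l)`**: irreducible + the Tate-curve transvection at `v₇` (`l ∤ 2`, `l ≠ 7`) — [GenEll] Lem. 3.1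
  (iii) in the tree's form `EllPoint.imageModLContainsSL2_of_not_admitsLCyclic_of_hasMultiplicativeReductionAt` — moved to the Legendre
  model by `EllPoint.imageModLContainsSL2_of_variableChange_eq`;
* §4 **UP to every theta-field** `F` (`IsThetaField.isGalois`, `finrank_dvd : [F:ℚ] ∣ 46080 = 2¹⁰3²5`, `l ∤ 46080`) by the tree's
  `EllPoint.imageModLContainsSL2_map_of_isGalois_of_not_dvd`, and `thetaCurve (ratPoint λ) F` IS the base-changed Legendre model:
  `condP6_of_certificate`, `condP6_eleven / _thirteen / _seventeen / _nineteen` — TYPE VERBATIM `Cor22.CondP6 (ratPoint λ) l`.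

HONEST SCOPE: (P6) is a classical Galois-image statement about ONE elliptic curve over `ℚ` and its `15`-division field; nothing here
is about Θ-data, [IUTchIII] Cor. 3.12 or any disputed step; no side taken on any author; refuted-as-typed ≠ refuted-in-print for the
apices this feeds; typed ≠ proved for every IUT sentence; no abc claim.
[cite: Mochizuki2012, IUTchIV Cor. 2.2 (ii) proof (P6) p. 46; IUTchI Def. 3.1 (c) p. 62] [cite: Mazur1978, §6 Prop. 6.3 (1) p. 153]
[cite: Serre1972PointsOrdreFini, §2, Prop. 15] [cite: MochizukiGenEll2010, Lem. 3.1 (iii) p. 14] [cite: SilvermanAEC2009, VII.1 Rem. 1.1,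
VII.5 Prop. 5.1(b), III.1 Table 3.1] [claim: Mochizuki2012, status: disputed] for every IUT quotation.
-/

noncomputable section

open scoped Classical
open NumberField IsDedekindDomain WeierstrassCurve

namespace Summit.ABC.IUTFork.Conditional

namespace FreyP6

open Literature.NumberTheory.EllipticCurves Literature.NumberTheory.DiophantineGeometry.GenEll
open Literature.NumberTheory.DiophantineGeometry

/-! ## §1 The integer model `E₁ = [0, −(c²+ac), 0, ac³, 0]` and its Frobenius trace at `29` -/

/-- `E₁ mod 29 = [0, 13, 0, 11, 0]`. [folklore] -/
theorem model_map_29 :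
    (⟨0, -(((11 ^ 8 * 109 ^ 2 * 3677 ^ 3 : ℕ) : ℤ) ^ 2 + (2 * 5 ^ 10 * 13 ^ 4 : ℕ) * (11 ^ 8 * 109 ^ 2 * 3677 ^ 3 : ℕ)), 0,
      ((2 * 5 ^ 10 * 13 ^ 4 : ℕ) : ℤ) * ((11 ^ 8 * 109 ^ 2 * 3677 ^ 3 : ℕ) : ℤ) ^ 3, 0⟩ : WeierstrassCurve ℤ).map
      (Int.castRingHom (ZMod 29)) = ⟨0, 13, 0, 11, 0⟩ := by
  ext <;> decide +kernel

/-- `#Ẽ₁(𝔽₂₉) = 36` (kernel count, Euler's criterion column by column). [folklore] -/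
theorem natCard_point_29 : Nat.card (⟨0, 13, 0, 11, 0⟩ : WeierstrassCurve (ZMod 29)).toAffine.Point = 36 := by
  rw [@WeierstrassCurve.natCard_point_eq_one_add_card (ZMod 29) (@ZMod.instField 29 ⟨by norm_num⟩) _ _ _
    (by decide +kernel), @card_sol_eq_sum_euler (ZMod 29) (@ZMod.instField 29 ⟨by norm_num⟩) _ _
    (by rw [ZMod.ringChar_zmod_n]; decide)]
  decide +kernel

/-- `a₂₉(E₁) = 29 + 1 − 36 = −6`. [folklore] -/
theorem frobeniusTrace_29 : Literature.NumberTheory.Automorphic.frobeniusTrace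
    (⟨0, -(((11 ^ 8 * 109 ^ 2 * 3677 ^ 3 : ℕ) : ℤ) ^ 2 + (2 * 5 ^ 10 * 13 ^ 4 : ℕ) * (11 ^ 8 * 109 ^ 2 * 3677 ^ 3 : ℕ)), 0,
      ((2 * 5 ^ 10 * 13 ^ 4 : ℕ) : ℤ) * ((11 ^ 8 * 109 ^ 2 * 3677 ^ 3 : ℕ) : ℤ) ^ 3, 0⟩ : WeierstrassCurve ℤ) 29 = -6 := by
  rw [Literature.NumberTheory.Automorphic.frobeniusTrace, Literature.NumberTheory.Automorphic.numPointsMod,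
    model_map_29, natCard_point_29]; norm_num

/-- `Δ(E₁) = 16a²b²c⁸ = 7²·(16·a²·(3¹⁵31⁷45817)²·c⁸)`. [folklore] -/
theorem Δ_eq :
    (⟨0, -(((11 ^ 8 * 109 ^ 2 * 3677 ^ 3 : ℕ) : ℤ) ^ 2 + (2 * 5 ^ 10 * 13 ^ 4 : ℕ) * (11 ^ 8 * 109 ^ 2 * 3677 ^ 3 : ℕ)), 0,
      ((2 * 5 ^ 10 * 13 ^ 4 : ℕ) : ℤ) * ((11 ^ 8 * 109 ^ 2 * 3677 ^ 3 : ℕ) : ℤ) ^ 3, 0⟩ : WeierstrassCurve ℤ).Δ =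
      7 ^ 2 * (16 * (2 * 5 ^ 10 * 13 ^ 4) ^ 2 * (3 ^ 15 * 31 ^ 7 * 45817) ^ 2 * (11 ^ 8 * 109 ^ 2 * 3677 ^ 3) ^ 8) := by
  norm_num [WeierstrassCurve.Δ, WeierstrassCurve.b₂, WeierstrassCurve.b₄, WeierstrassCurve.b₆, WeierstrassCurve.b₈]

/-- `29 ∤ Δ(E₁)`. [folklore] -/
theorem not_dvd_Δ_29 : ¬ ((29 : ℕ) : ℤ) ∣
    (⟨0, -(((11 ^ 8 * 109 ^ 2 * 3677 ^ 3 : ℕ) : ℤ) ^ 2 + (2 * 5 ^ 10 * 13 ^ 4 : ℕ) * (11 ^ 8 * 109 ^ 2 * 3677 ^ 3 : ℕ)), 0,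
      ((2 * 5 ^ 10 * 13 ^ 4 : ℕ) : ℤ) * ((11 ^ 8 * 109 ^ 2 * 3677 ^ 3 : ℕ) : ℤ) ^ 3, 0⟩ : WeierstrassCurve ℤ).Δ := by
  rw [Δ_eq]; norm_num

/-- **`ρ̄_{E₁,l}` is irreducible over `ℚ` for every prime `l ≠ 29` at which `t² + 6t + 29` has no root mod `l`**
(Mazur's Frobenius certificate at the good prime `29`, `a₂₉ = −6`; tree theorem
`Summit.BirchSwinnertonDyer.Rank2.hasIrreducibleModPGaloisRep_map_of_noroot`). [cite: Mazur1978, §6 Prop. 6.3 (1) (p. 153)] -/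
theorem hasIrreducibleModPGaloisRep_of_noroot (l : ℕ) [Fact l.Prime] (h29 : 29 ≠ l)
    (hnoroot : ∀ t : ZMod l, t ^ 2 - ((-6 : ℤ) : ZMod l) * t + ((29 : ℕ) : ZMod l) ≠ 0) :
    ((⟨0, -(((11 ^ 8 * 109 ^ 2 * 3677 ^ 3 : ℕ) : ℤ) ^ 2 + (2 * 5 ^ 10 * 13 ^ 4 : ℕ) * (11 ^ 8 * 109 ^ 2 * 3677 ^ 3 : ℕ)), 0,
      ((2 * 5 ^ 10 * 13 ^ 4 : ℕ) : ℤ) * ((11 ^ 8 * 109 ^ 2 * 3677 ^ 3 : ℕ) : ℤ) ^ 3, 0⟩ : WeierstrassCurve ℤ).map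
      (Int.castRingHom ℚ)).HasIrreducibleModPGaloisRep l := by
  haveI : Fact (Nat.Prime 29) := ⟨by norm_num⟩
  refine Summit.BirchSwinnertonDyer.Rank2.hasIrreducibleModPGaloisRep_map_of_noroot _ l 29 h29 not_dvd_Δ_29 ?_
  rw [frobeniusTrace_29]
  exact hnoroot

/-- `t² + 6t + 29` has no root in `𝔽₁₁` (discriminant `36 − 116 ≡ 8`, a non-residue mod `11`). [folklore] -/
theorem noroot_11 : ∀ t : ZMod 11, t ^ 2 - ((-6 : ℤ) : ZMod 11) * t + ((29 : ℕ) : ZMod 11) ≠ 0 := by decide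

/-- `t² + 6t + 29` has no root in `𝔽₁₃` (discriminant `36 − 116 ≡ 11`, a non-residue mod `13`). [folklore] -/
theorem noroot_13 : ∀ t : ZMod 13, t ^ 2 - ((-6 : ℤ) : ZMod 13) * t + ((29 : ℕ) : ZMod 13) ≠ 0 := by decide

/-- `t² + 6t + 29` has no root in `𝔽₁₇` (discriminant `36 − 116 ≡ 5`, a non-residue mod `17`). [folklore] -/
theorem noroot_17 : ∀ t : ZMod 17, t ^ 2 - ((-6 : ℤ) : ZMod 17) * t + ((29 : ℕ) : ZMod 17) ≠ 0 := by decide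

/-- `t² + 6t + 29` has no root in `𝔽₁₉` (discriminant `36 − 116 ≡ 15`, a non-residue mod `19`). [folklore] -/
theorem noroot_19 : ∀ t : ZMod 19, t ^ 2 - ((-6 : ℤ) : ZMod 19) * t + ((29 : ℕ) : ZMod 19) ≠ 0 := by decide

/-! ## §2 The place of `ℚ` over `7`: multiplicative reduction of `E₁/ℚ` with `ord₇(Δ_min) = 2` -/

/-- `E₁ mod 7 = [0, 3, 0, 4, 0]`. [folklore] -/
theorem model_map_7 :
    (⟨0, -(((11 ^ 8 * 109 ^ 2 * 3677 ^ 3 : ℕ) : ℤ) ^ 2 + (2 * 5 ^ 10 * 13 ^ 4 : ℕ) * (11 ^ 8 * 109 ^ 2 * 3677 ^ 3 : ℕ)), 0,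
      ((2 * 5 ^ 10 * 13 ^ 4 : ℕ) : ℤ) * ((11 ^ 8 * 109 ^ 2 * 3677 ^ 3 : ℕ) : ℤ) ^ 3, 0⟩ : WeierstrassCurve ℤ).map
      (Int.castRingHom (ZMod 7)) = ⟨0, 3, 0, 4, 0⟩ := by
  ext <;> decide +kernel

/-- `7 ∤ c₄(E₁)` (`c₄ ≡ 1 mod 7`). [folklore] -/
theorem not_dvd_c₄_7 : ¬ ((7 : ℕ) : ℤ) ∣
    (⟨0, -(((11 ^ 8 * 109 ^ 2 * 3677 ^ 3 : ℕ) : ℤ) ^ 2 + (2 * 5 ^ 10 * 13 ^ 4 : ℕ) * (11 ^ 8 * 109 ^ 2 * 3677 ^ 3 : ℕ)), 0,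
      ((2 * 5 ^ 10 * 13 ^ 4 : ℕ) : ℤ) * ((11 ^ 8 * 109 ^ 2 * 3677 ^ 3 : ℕ) : ℤ) ^ 3, 0⟩ : WeierstrassCurve ℤ).c₄ := by
  rw [← ZMod.intCast_zmod_eq_zero_iff_dvd]
  have h := congrArg WeierstrassCurve.c₄ model_map_7
  simp only [map_c₄, eq_intCast] at h
  rw [h]
  decide +kernel

/-- The place of `𝓞_ℚ` over `7` contains `7`. [folklore] -/
theorem seven_mem_asIdeal :
    (7 : 𝓞 ℚ) ∈ ((Rat.HeightOneSpectrum.primesEquiv (R := 𝓞 ℚ)).symm ⟨7, by norm_num⟩).asIdeal := by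
  set v := (Rat.HeightOneSpectrum.primesEquiv (R := 𝓞 ℚ)).symm ⟨7, by norm_num⟩ with hv
  have hgen : Rat.HeightOneSpectrum.natGenerator v = 7 :=
    congrArg Subtype.val ((Rat.HeightOneSpectrum.primesEquiv (R := 𝓞 ℚ)).apply_symm_apply ⟨7, _⟩)
  have h : ((7 : ℕ) : 𝓞 ℚ) ∈ v.asIdeal := by
    rw [← Ideal.apply_mem_of_equiv_iff (f := Rat.IsIntegralClosure.intEquiv (𝓞 ℚ)), map_natCast,
      ← Rat.HeightOneSpectrum.natGenerator_dvd_iff, hgen]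
  exact_mod_cast h

/-- The place over `7` is the ideal `(7)` of `𝓞_ℚ`. [folklore] -/
theorem asIdeal_seven :
    ((Rat.HeightOneSpectrum.primesEquiv (R := 𝓞 ℚ)).symm ⟨7, by norm_num⟩).asIdeal = Ideal.span {(7 : 𝓞 ℚ)} := by
  set v := (Rat.HeightOneSpectrum.primesEquiv (R := 𝓞 ℚ)).symm ⟨7, by norm_num⟩ with hv
  have hgen : Rat.HeightOneSpectrum.natGenerator v = 7 :=
    congrArg Subtype.val ((Rat.HeightOneSpectrum.primesEquiv (R := 𝓞 ℚ)).apply_symm_apply ⟨7, _⟩)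
  have hspan := Rat.HeightOneSpectrum.span_natGenerator v
  rw [hgen] at hspan
  rw [← v.asIdeal.comap_map_of_bijective _ (Rat.IsIntegralClosure.intEquiv (𝓞 ℚ)).bijective,
    ← hspan, ← Ideal.map_symm, Ideal.map_span, Set.image_singleton, map_natCast]
  norm_cast

/-- A natural number `n` with `7 ∤ n` does not lie in the place over `7`. [folklore] -/
theorem natCast_not_mem_asIdeal_seven {n : ℕ} (hn : ¬ 7 ∣ n) :
    (n : 𝓞 ℚ) ∉ ((Rat.HeightOneSpectrum.primesEquiv (R := 𝓞 ℚ)).symm ⟨7, by norm_num⟩).asIdeal := by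
  rw [asIdeal_seven, Ideal.mem_span_singleton]
  intro h
  apply hn
  have h' := map_dvd (Rat.IsIntegralClosure.intEquiv (𝓞 ℚ)) h
  rw [map_natCast, map_ofNat] at h'
  exact_mod_cast h'

/-- `primesEquiv` of the place over `7` is `7`. [folklore] -/
theorem primesEquiv_seven :
    ((Rat.HeightOneSpectrum.primesEquiv (R := 𝓞 ℚ)
      ((Rat.HeightOneSpectrum.primesEquiv (R := 𝓞 ℚ)).symm ⟨7, by norm_num⟩) : ℕ)) = 7 :=
  congrArg Subtype.val ((Rat.HeightOneSpectrum.primesEquiv (R := 𝓞 ℚ)).apply_symm_apply ⟨7, _⟩)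

/-- `E₁/ℚ` is integral at every finite place. [folklore] -/
theorem isIntegralAt (v : HeightOneSpectrum (𝓞 ℚ)) :
    ((⟨0, -(((11 ^ 8 * 109 ^ 2 * 3677 ^ 3 : ℕ) : ℤ) ^ 2 + (2 * 5 ^ 10 * 13 ^ 4 : ℕ) * (11 ^ 8 * 109 ^ 2 * 3677 ^ 3 : ℕ)), 0,
      ((2 * 5 ^ 10 * 13 ^ 4 : ℕ) : ℤ) * ((11 ^ 8 * 109 ^ 2 * 3677 ^ 3 : ℕ) : ℤ) ^ 3, 0⟩ : WeierstrassCurve ℤ).map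
      (Int.castRingHom ℚ)).IsIntegralAt v := by
  refine isIntegralAt_of_valuation_le_one v _ ?_ ?_ ?_ ?_ ?_
  · rw [map_a₁, eq_intCast]; exact Literature.NumberTheory.Automorphic.valuation_intCast_le_one v _
  · rw [map_a₂, eq_intCast]; exact Literature.NumberTheory.Automorphic.valuation_intCast_le_one v _
  · rw [map_a₃, eq_intCast]; exact Literature.NumberTheory.Automorphic.valuation_intCast_le_one v _
  · rw [map_a₄, eq_intCast]; exact Literature.NumberTheory.Automorphic.valuation_intCast_le_one v _
  · rw [map_a₆, eq_intCast]; exact Literature.NumberTheory.Automorphic.valuation_intCast_le_one v _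

/-- `v₇(c₄(E₁)) = 1` (a `7`-adic unit). [folklore] -/
theorem valuation_c₄_seven :
    ((Rat.HeightOneSpectrum.primesEquiv (R := 𝓞 ℚ)).symm ⟨7, by norm_num⟩).valuation ℚ
      ((⟨0, -(((11 ^ 8 * 109 ^ 2 * 3677 ^ 3 : ℕ) : ℤ) ^ 2 + (2 * 5 ^ 10 * 13 ^ 4 : ℕ) * (11 ^ 8 * 109 ^ 2 * 3677 ^ 3 : ℕ)), 0,
      ((2 * 5 ^ 10 * 13 ^ 4 : ℕ) : ℤ) * ((11 ^ 8 * 109 ^ 2 * 3677 ^ 3 : ℕ) : ℤ) ^ 3, 0⟩ : WeierstrassCurve ℤ).map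
      (Int.castRingHom ℚ)).c₄ = 1 := by
  rw [map_c₄, eq_intCast]
  refine Literature.NumberTheory.Automorphic.valuation_intCast_eq_one_of_not_dvd _ ?_
  rw [primesEquiv_seven]
  exact not_dvd_c₄_7

/-- `v₇(7) = exp(−1)`. [folklore] -/
theorem valuation_seven :
    ((Rat.HeightOneSpectrum.primesEquiv (R := 𝓞 ℚ)).symm ⟨7, by norm_num⟩).valuation ℚ (7 : ℚ) =
      WithZero.exp (-1 : ℤ) := by
  rw [← map_ofNat (algebraMap (𝓞 ℚ) ℚ) 7, HeightOneSpectrum.valuation_of_algebraMap]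
  exact HeightOneSpectrum.intValuation_singleton _ (by norm_num) asIdeal_seven

/-- `v₇(Δ(E₁)) = exp(−2)`. [folklore] -/
theorem valuation_Δ_seven :
    ((Rat.HeightOneSpectrum.primesEquiv (R := 𝓞 ℚ)).symm ⟨7, by norm_num⟩).valuation ℚ
      ((⟨0, -(((11 ^ 8 * 109 ^ 2 * 3677 ^ 3 : ℕ) : ℤ) ^ 2 + (2 * 5 ^ 10 * 13 ^ 4 : ℕ) * (11 ^ 8 * 109 ^ 2 * 3677 ^ 3 : ℕ)), 0,
      ((2 * 5 ^ 10 * 13 ^ 4 : ℕ) : ℤ) * ((11 ^ 8 * 109 ^ 2 * 3677 ^ 3 : ℕ) : ℤ) ^ 3, 0⟩ : WeierstrassCurve ℤ).map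
      (Int.castRingHom ℚ)).Δ = WithZero.exp (-2 : ℤ) := by
  rw [map_Δ, eq_intCast, Δ_eq, Int.cast_mul, Int.cast_pow, map_mul, map_pow]
  have h7 : ((7 : ℤ) : ℚ) = 7 := by norm_num
  rw [h7, valuation_seven,
    Literature.NumberTheory.Automorphic.valuation_intCast_eq_one_of_not_dvd _ (by rw [primesEquiv_seven]; norm_num),
    mul_one, sq, ← WithZero.exp_add]
  norm_num

/-- **`E₁/ℚ` has multiplicative reduction at the place over `7`.** [cite: SilvermanAEC2009, VII.5 Prop. 5.1(b)] -/
theorem hasMultiplicativeReductionAt_seven :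
    ((⟨0, -(((11 ^ 8 * 109 ^ 2 * 3677 ^ 3 : ℕ) : ℤ) ^ 2 + (2 * 5 ^ 10 * 13 ^ 4 : ℕ) * (11 ^ 8 * 109 ^ 2 * 3677 ^ 3 : ℕ)), 0,
      ((2 * 5 ^ 10 * 13 ^ 4 : ℕ) : ℤ) * ((11 ^ 8 * 109 ^ 2 * 3677 ^ 3 : ℕ) : ℤ) ^ 3, 0⟩ : WeierstrassCurve ℤ).map
      (Int.castRingHom ℚ)).HasMultiplicativeReductionAt
      ((Rat.HeightOneSpectrum.primesEquiv (R := 𝓞 ℚ)).symm ⟨7, by norm_num⟩) := by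
  haveI := Summit.BirchSwinnertonDyer.Rank2.isElliptic_map_of_Δ_ne_zero
    (⟨0, -(((11 ^ 8 * 109 ^ 2 * 3677 ^ 3 : ℕ) : ℤ) ^ 2 + (2 * 5 ^ 10 * 13 ^ 4 : ℕ) * (11 ^ 8 * 109 ^ 2 * 3677 ^ 3 : ℕ)), 0,
      ((2 * 5 ^ 10 * 13 ^ 4 : ℕ) : ℤ) * ((11 ^ 8 * 109 ^ 2 * 3677 ^ 3 : ℕ) : ℤ) ^ 3, 0⟩ : WeierstrassCurve ℤ)
    (by rw [Δ_eq]; norm_num)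
  refine hasMultiplicativeReductionAt_of_valuation_c₄_eq_one (isIntegralAt _) valuation_c₄_seven ?_
  rw [valuation_Δ_seven, ← WithZero.exp_zero]
  exact WithZero.exp_lt_exp.mpr (by norm_num)

/-- **`ord₇(Δ_min(E₁/ℚ)) = 2`** (the model is integral with `v₇(c₄) = 0 < 4`, hence minimal at `7`).
[cite: SilvermanAEC2009, VII.1 Remark 1.1] -/
theorem ordMinimalDiscriminant_seven :
    ((⟨0, -(((11 ^ 8 * 109 ^ 2 * 3677 ^ 3 : ℕ) : ℤ) ^ 2 + (2 * 5 ^ 10 * 13 ^ 4 : ℕ) * (11 ^ 8 * 109 ^ 2 * 3677 ^ 3 : ℕ)), 0,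
      ((2 * 5 ^ 10 * 13 ^ 4 : ℕ) : ℤ) * ((11 ^ 8 * 109 ^ 2 * 3677 ^ 3 : ℕ) : ℤ) ^ 3, 0⟩ : WeierstrassCurve ℤ).map
      (Int.castRingHom ℚ)).ordMinimalDiscriminant
      ((Rat.HeightOneSpectrum.primesEquiv (R := 𝓞 ℚ)).symm ⟨7, by norm_num⟩) = 2 := by
  haveI := Summit.BirchSwinnertonDyer.Rank2.isElliptic_map_of_Δ_ne_zero
    (⟨0, -(((11 ^ 8 * 109 ^ 2 * 3677 ^ 3 : ℕ) : ℤ) ^ 2 + (2 * 5 ^ 10 * 13 ^ 4 : ℕ) * (11 ^ 8 * 109 ^ 2 * 3677 ^ 3 : ℕ)), 0,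
      ((2 * 5 ^ 10 * 13 ^ 4 : ℕ) : ℤ) * ((11 ^ 8 * 109 ^ 2 * 3677 ^ 3 : ℕ) : ℤ) ^ 3, 0⟩ : WeierstrassCurve ℤ)
    (by rw [Δ_eq]; norm_num)
  set v := (Rat.HeightOneSpectrum.primesEquiv (R := 𝓞 ℚ)).symm ⟨7, by norm_num⟩ with hv
  have hmin := isMinimalAt_of_lt_valuation_c₄ (isIntegralAt v)
    (by rw [valuation_c₄_seven, ← WithZero.exp_zero]; exact WithZero.exp_lt_exp.mpr (by norm_num))
  have h1 := valuation_Δ_eq_of_isMinimalAt_holds v _ hmin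
  rw [valuation_Δ_seven, WithZero.exp_inj, neg_inj] at h1
  exact_mod_cast h1.symm


/-! ## §3 The image of `Γ_ℚ` on `E₁[13]`, then on the Legendre model `y² = x(x−1)(x−λ)` over `ℚ` -/

/-- `E₁/ℚ` is an elliptic curve (`Δ ≠ 0`). [folklore] -/
theorem isElliptic_model :
    ((⟨0, -(((11 ^ 8 * 109 ^ 2 * 3677 ^ 3 : ℕ) : ℤ) ^ 2 + (2 * 5 ^ 10 * 13 ^ 4 : ℕ) * (11 ^ 8 * 109 ^ 2 * 3677 ^ 3 : ℕ)), 0,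
      ((2 * 5 ^ 10 * 13 ^ 4 : ℕ) : ℤ) * ((11 ^ 8 * 109 ^ 2 * 3677 ^ 3 : ℕ) : ℤ) ^ 3, 0⟩ : WeierstrassCurve ℤ).map
      (Int.castRingHom ℚ)).IsElliptic :=
  Summit.BirchSwinnertonDyer.Rank2.isElliptic_map_of_Δ_ne_zero _ (by rw [Δ_eq]; norm_num)

/-- **The image of `Γ_ℚ` in `Aut(E₁[l]) ≅ GL₂(𝔽_l)` contains `SL₂(𝔽_l)`** for every prime `l ∉ {2, 7, 29}` carrying the
Frobenius certificate at `29`: irreducible (Mazur) plus the Tate-curve transvection at the multiplicative place over `7 ≠ l`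
with `l ∤ ord₇(Δ_min) = 2` ([GenEll] Lem. 3.1 (iii) — the tree's
`EllPoint.imageModLContainsSL2_of_not_admitsLCyclic_of_hasMultiplicativeReductionAt`). [cite: MochizukiGenEll2010, Lem 3.1 (iii) p.14] -/
theorem imageModLContainsSL2_model (l : ℕ) [Fact l.Prime] (h29 : 29 ≠ l) (h7 : ¬ 7 ∣ l) (h2 : ¬ l ∣ 2)
    (hnoroot : ∀ t : ZMod l, t ^ 2 - ((-6 : ℤ) : ZMod l) * t + ((29 : ℕ) : ZMod l) ≠ 0) :
    (@EllPoint.mk ℚ _ _ ((⟨0, -(((11 ^ 8 * 109 ^ 2 * 3677 ^ 3 : ℕ) : ℤ) ^ 2 + (2 * 5 ^ 10 * 13 ^ 4 : ℕ) * (11 ^ 8 * 109 ^ 2 * 3677 ^ 3 : ℕ)), 0,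
      ((2 * 5 ^ 10 * 13 ^ 4 : ℕ) : ℤ) * ((11 ^ 8 * 109 ^ 2 * 3677 ^ 3 : ℕ) : ℤ) ^ 3, 0⟩ : WeierstrassCurve ℤ).map
      (Int.castRingHom ℚ)) isElliptic_model).ImageModLContainsSL2 l := by
  haveI := isElliptic_model
  set P : EllPoint := @EllPoint.mk ℚ _ _ ((⟨0, -(((11 ^ 8 * 109 ^ 2 * 3677 ^ 3 : ℕ) : ℤ) ^ 2 +
      (2 * 5 ^ 10 * 13 ^ 4 : ℕ) * (11 ^ 8 * 109 ^ 2 * 3677 ^ 3 : ℕ)), 0,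
      ((2 * 5 ^ 10 * 13 ^ 4 : ℕ) : ℤ) * ((11 ^ 8 * 109 ^ 2 * 3677 ^ 3 : ℕ) : ℤ) ^ 3, 0⟩ : WeierstrassCurve ℤ).map
      (Int.castRingHom ℚ)) isElliptic_model with hP
  have hno : ¬ P.AdmitsLCyclic l := fun hcyc =>
    (Mazur1978.not_hasIrreducibleModPGaloisRep_iff_exists_natCard_eq P.W l).mpr hcyc
      (hasIrreducibleModPGaloisRep_of_noroot l h29 hnoroot)
  exact P.imageModLContainsSL2_of_not_admitsLCyclic_of_hasMultiplicativeReductionAt l hno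
    hasMultiplicativeReductionAt_seven (natCast_not_mem_asIdeal_seven h7) (by rw [ordMinimalDiscriminant_seven]; exact h2)

/-- The Legendre model `[0, −(1+λ), 0, λ, 0]`, `λ = a/c`, is elliptic (`λ ≠ 0, 1`). [cite: SilvermanAEC2009, Prop. III.1.7] -/
theorem isElliptic_legendre :
    (⟨0, -(1 + ((2 * 5 ^ 10 * 13 ^ 4 : ℕ) : ℚ) / (11 ^ 8 * 109 ^ 2 * 3677 ^ 3 : ℕ)), 0,
      ((2 * 5 ^ 10 * 13 ^ 4 : ℕ) : ℚ) / (11 ^ 8 * 109 ^ 2 * 3677 ^ 3 : ℕ), 0⟩ : WeierstrassCurve ℚ).IsElliptic :=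
  (legendre_isElliptic_iff (F := ℚ) two_ne_zero _).2 ⟨by norm_num, by norm_num⟩

/-- `E₁/ℚ` is the Legendre model rescaled by `u = c`: `⟨c, 0, 0, 0⟩ • E₁ = [0, −(1+λ), 0, λ, 0]`. [cite: SilvermanAEC2009, III.1 Table 3.1] -/
theorem variableChange_model_eq_legendre :
    (⟨Units.mk0 ((11 ^ 8 * 109 ^ 2 * 3677 ^ 3 : ℕ) : ℚ) (by norm_num), 0, 0, 0⟩ : VariableChange ℚ) •
      ((⟨0, -(((11 ^ 8 * 109 ^ 2 * 3677 ^ 3 : ℕ) : ℤ) ^ 2 + (2 * 5 ^ 10 * 13 ^ 4 : ℕ) * (11 ^ 8 * 109 ^ 2 * 3677 ^ 3 : ℕ)), 0,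
      ((2 * 5 ^ 10 * 13 ^ 4 : ℕ) : ℤ) * ((11 ^ 8 * 109 ^ 2 * 3677 ^ 3 : ℕ) : ℤ) ^ 3, 0⟩ : WeierstrassCurve ℤ).map
      (Int.castRingHom ℚ)) =
    (⟨0, -(1 + ((2 * 5 ^ 10 * 13 ^ 4 : ℕ) : ℚ) / (11 ^ 8 * 109 ^ 2 * 3677 ^ 3 : ℕ)), 0,
      ((2 * 5 ^ 10 * 13 ^ 4 : ℕ) : ℚ) / (11 ^ 8 * 109 ^ 2 * 3677 ^ 3 : ℕ), 0⟩ : WeierstrassCurve ℚ) := by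
  ext
  · simp [variableChange_a₁]
  · rw [variableChange_a₂]; simp [Units.val_inv_eq_inv_val]; field_simp; norm_num
  · simp [variableChange_a₃]
  · rw [variableChange_a₄]; simp [Units.val_inv_eq_inv_val]; field_simp; norm_num
  · simp [variableChange_a₆]

/-- **The image of `Γ_ℚ` on the `l`-torsion of the Legendre curve `y² = x(x−1)(x−λ)`, `λ = 2·5¹⁰13⁴/(11⁸109²3677³)`,
contains `SL₂(𝔽_l)`** for every prime `l ∉ {2, 7, 29}` carrying the Frobenius certificate at `29` ((P6) does not see the
change of model; tree `EllPoint.imageModLContainsSL2_of_variableChange_eq`). [cite: Mochizuki2012, IUTchIV Cor. 2.2 (ii) (P6) p.46] -/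
theorem imageModLContainsSL2_legendre (l : ℕ) [Fact l.Prime] (h29 : 29 ≠ l) (h7 : ¬ 7 ∣ l) (h2 : ¬ l ∣ 2)
    (hnoroot : ∀ t : ZMod l, t ^ 2 - ((-6 : ℤ) : ZMod l) * t + ((29 : ℕ) : ZMod l) ≠ 0) :
    (@EllPoint.mk ℚ _ _ (⟨0, -(1 + ((2 * 5 ^ 10 * 13 ^ 4 : ℕ) : ℚ) / (11 ^ 8 * 109 ^ 2 * 3677 ^ 3 : ℕ)), 0,
      ((2 * 5 ^ 10 * 13 ^ 4 : ℕ) : ℚ) / (11 ^ 8 * 109 ^ 2 * 3677 ^ 3 : ℕ), 0⟩ : WeierstrassCurve ℚ)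
      isElliptic_legendre).ImageModLContainsSL2 l :=
  @EllPoint.imageModLContainsSL2_of_variableChange_eq ℚ _ _ _ _ isElliptic_model isElliptic_legendre _
    variableChange_model_eq_legendre l _ (imageModLContainsSL2_model l h29 h7 h2 hnoroot)

end FreyP6

/-! ## §4 (P6) at `(ratPoint λ, l)` for `l = 11, 13, 17, 19` -/

section CondP6

open Literature.NumberTheory.EllipticCurves Literature.NumberTheory.DiophantineGeometry.GenEll
  Literature.NumberTheory.DiophantineGeometry Literature.IUT.LogVolume

/-- **(P6) at `(ratPoint λ, l)` from the Frobenius certificate at `29`**: for every prime `l ∉ {2, 7, 29}` not dividing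
`46080 = 2¹⁰·3²·5` at which `t² + 6t + 29` has no root mod `l`, `Cor22.CondP6 (ratPoint λ) l` holds for
`λ = 2·5¹⁰·13⁴/(11⁸·109²·3677³)`: for every theta-field `F = ℚ(√−1, E[15])` (`Cor22.IsThetaField`: Galois over `ℚ` of
degree dividing `46080`) the image of `Gal(F̄/F)` on `E_F[l]` contains `SL₂(𝔽_l)` — over `ℚ` by
`FreyP6.imageModLContainsSL2_legendre`, UP to `F` by the tree's `EllPoint.imageModLContainsSL2_map_of_isGalois_of_not_dvd`
(`l ∤ [F : ℚ]`), and the base-changed Legendre model IS `Cor22.thetaCurve (ratPoint λ) F`. Classical (Serre/Mazur), undisputed.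
[cite: Mochizuki2012, IUTchIV Cor. 2.2 (ii) (P6) p.46] -/
theorem condP6_of_certificate (l : ℕ) [Fact l.Prime] (h29 : 29 ≠ l) (h7 : ¬ 7 ∣ l) (h2 : ¬ l ∣ 2)
    (h46080 : ¬ l ∣ 46080) (hnoroot : ∀ t : ZMod l, t ^ 2 - ((-6 : ℤ) : ZMod l) * t + ((29 : ℕ) : ZMod l) ≠ 0) :
    Cor22.CondP6 (ratPoint (((2 * 5 ^ 10 * 13 ^ 4 : ℕ) : ℚ) / (11 ^ 8 * 109 ^ 2 * 3677 ^ 3 : ℕ))) l := by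
  intro hU F _ _ iA hF _
  -- `[F : ℚ] ∣ 46080` is prime to `l`
  have hdeg : ¬ l ∣ Module.finrank (ratPoint (((2 * 5 ^ 10 * 13 ^ 4 : ℕ) : ℚ) / (11 ^ 8 * 109 ^ 2 * 3677 ^ 3 : ℕ))).F F :=
    fun h => h46080 (h.trans hF.finrank_dvd)
  -- UP from `ℚ` to the Galois extension `F`
  have hup := @EllPoint.imageModLContainsSL2_map_of_isGalois_of_not_dvd
    (@EllPoint.mk ℚ _ _ (⟨0, -(1 + ((2 * 5 ^ 10 * 13 ^ 4 : ℕ) : ℚ) / (11 ^ 8 * 109 ^ 2 * 3677 ^ 3 : ℕ)), 0,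
      ((2 * 5 ^ 10 * 13 ^ 4 : ℕ) : ℚ) / (11 ^ 8 * 109 ^ 2 * 3677 ^ 3 : ℕ), 0⟩ : WeierstrassCurve ℚ)
      FreyP6.isElliptic_legendre) F _ _ iA l _ hF.isGalois hdeg (FreyP6.imageModLContainsSL2_legendre l h29 h7 h2 hnoroot)
  -- the base-changed Legendre model is `thetaCurve P F`
  have hW : (1 : VariableChange F) •
      ((⟨0, -(1 + ((2 * 5 ^ 10 * 13 ^ 4 : ℕ) : ℚ) / (11 ^ 8 * 109 ^ 2 * 3677 ^ 3 : ℕ)), 0,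
        ((2 * 5 ^ 10 * 13 ^ 4 : ℕ) : ℚ) / (11 ^ 8 * 109 ^ 2 * 3677 ^ 3 : ℕ), 0⟩ : WeierstrassCurve ℚ).map
        (@algebraMap ℚ F _ _ iA)) =
      Cor22.thetaCurve (ratPoint (((2 * 5 ^ 10 * 13 ^ 4 : ℕ) : ℚ) / (11 ^ 8 * 109 ^ 2 * 3677 ^ 3 : ℕ))) F := by
    rw [one_smul]
    ext <;> simp [ratPoint, WeierstrassCurve.map]
  exact @EllPoint.imageModLContainsSL2_of_variableChange_eq F _ _ _ _ (_) (Cor22.thetaCurve_isElliptic hU F) 1 hW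
    l _ hup

/-- **(P6) HOLDS at the tier-1 datum `(ratPoint λ, 13)`**, `λ = 2·5¹⁰·13⁴/(11⁸·109²·3677³)` — the ONLY hypothesis of the apex
`Conditional.not_hSHwBad_frey` (p467486) is a theorem. [cite: Mochizuki2012, IUTchIV Cor. 2.2 (ii) (P6) p.46] -/
theorem condP6_thirteen :
    Cor22.CondP6 (ratPoint (((2 * 5 ^ 10 * 13 ^ 4 : ℕ) : ℚ) / (11 ^ 8 * 109 ^ 2 * 3677 ^ 3 : ℕ))) 13 :=
  haveI : Fact (Nat.Prime 13) := ⟨by norm_num⟩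
  condP6_of_certificate 13 (by norm_num) (by norm_num) (by norm_num) (by norm_num) FreyP6.noroot_13

/-- **(P6) HOLDS at `(ratPoint λ, 11)`** — the only hypothesis of `Conditional.not_hSHwBad_frey_eleven` (p467802) is a theorem.
[cite: Mochizuki2012, IUTchIV Cor. 2.2 (ii) (P6) p.46] -/
theorem condP6_eleven :
    Cor22.CondP6 (ratPoint (((2 * 5 ^ 10 * 13 ^ 4 : ℕ) : ℚ) / (11 ^ 8 * 109 ^ 2 * 3677 ^ 3 : ℕ))) 11 :=
  haveI : Fact (Nat.Prime 11) := ⟨by norm_num⟩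
  condP6_of_certificate 11 (by norm_num) (by norm_num) (by norm_num) (by norm_num) FreyP6.noroot_11

/-- **(P6) HOLDS at `(ratPoint λ, 17)`** — the only hypothesis of `Conditional.not_hSHwBad_frey_seventeen` (p468473) is a theorem.
[cite: Mochizuki2012, IUTchIV Cor. 2.2 (ii) (P6) p.46] -/
theorem condP6_seventeen :
    Cor22.CondP6 (ratPoint (((2 * 5 ^ 10 * 13 ^ 4 : ℕ) : ℚ) / (11 ^ 8 * 109 ^ 2 * 3677 ^ 3 : ℕ))) 17 :=
  haveI : Fact (Nat.Prime 17) := ⟨by norm_num⟩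
  condP6_of_certificate 17 (by norm_num) (by norm_num) (by norm_num) (by norm_num) FreyP6.noroot_17

/-- **(P6) HOLDS at `(ratPoint λ, 19)`** (the same certificate; recorded for the W table). [cite: Mochizuki2012, IUTchIV Cor. 2.2 (ii) (P6) p.46] -/
theorem condP6_nineteen :
    Cor22.CondP6 (ratPoint (((2 * 5 ^ 10 * 13 ^ 4 : ℕ) : ℚ) / (11 ^ 8 * 109 ^ 2 * 3677 ^ 3 : ℕ))) 19 :=
  haveI : Fact (Nat.Prime 19) := ⟨by norm_num⟩
  condP6_of_certificate 19 (by norm_num) (by norm_num) (by norm_num) (by norm_num) FreyP6.noroot_19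

end CondP6

end Summit.ABC.IUTFork.Conditional

end
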